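import Mathlib
import Summits.Ventures.HodgeRepro2.Tier7.Line3.HyperbolicSize

/-!
# Tier 7 — LINE 3 support: the modular group's lattice count in the cosh-size, and the Poincaré series of `SL(2, ℤ)`
(`Line3/HyperbolicLatticeCount.lean`; t7-L1-p1, gen 2; Mathlib + Line3/HyperbolicSize (+ PoincareKernel))

The last group-side hypothesis of `Line3/HyperbolicSize.continuous_kernelSum_SL2` is the polynomial COUNT of the lattice
points in the cosh-size, `#{γ : κ (ι γ) ≤ R} ≤ C' (1 + R)^β`. For the simplest lattice, the modular group `SL(2, ℤ)`
embedded in `SL(2, ℝ)`, it is a BOX COUNT through `κ_eq` (`κ g = (a² + b² + c² + d²) / 2`): `κ γ ≤ R` forces every entry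
into `[−√(2R), √(2R)]`, so at most `(2⌊√(2R)⌋ + 1)⁴ ≤ 256 (1 + R)²` matrices — `β = 2` (`count_SL2Z`). This is the crude
count of the memo's route (R2) (x1 l. 14928: «weight 5 + the plain box», `β = 2 < 5/2 = α` for the weight-5 coefficient);
the sharp hyperbolic count `≍ R` (`β = 1 + ε`, route (R1)) is p5's `NumberFieldHyperbolicCount` at the model level.
CONSEQUENCE (`continuous_kernelSum_SL2Z`): for every continuous `f : SL(2, ℝ) → ℂ` with `‖f g‖ ≤ C (1 + κ g)^(-α)`, `α > 2`,
the Poincaré series `K_f(x, y) = Σ'_{γ ∈ SL(2, ℤ)} f (x⁻¹ γ y)` converges absolutely at every point and is continuous on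
`SL(2, ℝ) × SL(2, ℝ)` — a statement about the real modular group and the real hyperbolic plane, with no displayed
hypothesis left on the group or the lattice; only the test function's decay is assumed (for the `D_k` coefficients it is
`α = k/2`, p1's Bergman rows: `k ≥ 5` suffices here). The cell's real lattice `U(W_A)(F)` at two `(1,1)`-places and one
definite place is NOT `SL(2, ℤ)`; this is the dictionary's model instance, not the real object (TYPING-CENSUS T7).

Sorry-free; axioms: propext / Classical.choice / Quot.sound. §8(d): uses an L-value-free non-vanishing device: NO.
-/

namespace Summit.Ventures.HodgeRepro2.Tier7.Line3.HyperbolicLatticeCount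

open UpperHalfPlane HyperbolicSize Filter Topology
open scoped MatrixGroups

/-- the entries of the real image of an integral matrix are the cast entries. -/
theorem coe_apply (γ : SL(2, ℤ)) (i j : Fin 2) :
    ((γ : SL(2, ℝ)) : Matrix (Fin 2) (Fin 2) ℝ) i j = ((γ i j : ℤ) : ℝ) := by
  rw [Matrix.SpecialLinearGroup.coe_matrix_coe, Matrix.map_apply, Int.coe_castRingHom]

/-- the cosh-size of the real image of `γ ∈ SL(2, ℤ)` in its integer entries. -/
theorem κ_coe (γ : SL(2, ℤ)) :
    κ (γ : SL(2, ℝ)) = (((γ 0 0 : ℤ) : ℝ) ^ 2 + ((γ 0 1 : ℤ) : ℝ) ^ 2 + ((γ 1 0 : ℤ) : ℝ) ^ 2 +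
      ((γ 1 1 : ℤ) : ℝ) ^ 2) / 2 := by
  rw [κ_eq]
  simp only [coe_apply]

/-- `κ γ ≤ R` bounds every entry: `|γ i j| ≤ ⌊√(2R)⌋₊`. -/
theorem natAbs_le_of_κ_le {γ : SL(2, ℤ)} {R : ℝ} (h : κ (γ : SL(2, ℝ)) ≤ R) (i j : Fin 2) :
    (γ i j).natAbs ≤ ⌊Real.sqrt (2 * R)⌋₊ := by
  have hκ := κ_coe γ
  rw [hκ] at h
  have hsq : ((γ i j : ℤ) : ℝ) ^ 2 ≤ 2 * R := by
    fin_cases i <;> fin_cases j <;> simp only [Fin.zero_eta, Fin.mk_one] <;>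
      nlinarith [sq_nonneg ((γ 0 0 : ℤ) : ℝ), sq_nonneg ((γ 0 1 : ℤ) : ℝ), sq_nonneg ((γ 1 0 : ℤ) : ℝ),
        sq_nonneg ((γ 1 1 : ℤ) : ℝ)]
  apply Nat.le_floor
  rw [Nat.cast_natAbs, Int.cast_abs]
  exact Real.abs_le_sqrt hsq

/-- the entry map `SL(2, ℤ) → ℤ⁴`. -/
def entries (γ : SL(2, ℤ)) : ℤ × ℤ × ℤ × ℤ := (γ 0 0, γ 0 1, γ 1 0, γ 1 1)

/-- the entry map is injective (a matrix is its entries). -/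
theorem entries_injective : Function.Injective entries := by
  intro γ δ h
  simp only [entries, Prod.mk.injEq] at h
  apply Matrix.SpecialLinearGroup.ext
  intro i j
  fin_cases i <;> fin_cases j <;> simp only [Fin.zero_eta, Fin.mk_one] <;> tauto

/-- the integer box `[−M, M]⁴`. -/
noncomputable def box (M : ℕ) : Finset (ℤ × ℤ × ℤ × ℤ) :=
  (Finset.Icc (-(M : ℤ)) M) ×ˢ (Finset.Icc (-(M : ℤ)) M) ×ˢ (Finset.Icc (-(M : ℤ)) M) ×ˢ (Finset.Icc (-(M : ℤ)) M)

/-- the box has `(2M + 1)⁴` points. -/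
theorem card_box (M : ℕ) : (box M).card = (2 * M + 1) ^ 4 := by
  simp only [box, Finset.card_product, Int.card_Icc]
  have h : ((M : ℤ) + 1 - -(M : ℤ)).toNat = 2 * M + 1 := by omega
  rw [h]; ring

/-- a quadruple with all `|x_i| ≤ M` lies in the box. -/
theorem mem_box_of_natAbs_le {M : ℕ} {x : ℤ × ℤ × ℤ × ℤ} (h1 : x.1.natAbs ≤ M) (h2 : x.2.1.natAbs ≤ M)
    (h3 : x.2.2.1.natAbs ≤ M) (h4 : x.2.2.2.natAbs ≤ M) : x ∈ box M := by
  simp only [box, Finset.mem_product, Finset.mem_Icc]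
  omega

/-- **THE MODULAR GROUP'S COUNT IN THE COSH-SIZE**: `#{γ ∈ SL(2, ℤ) : κ γ ≤ R} ≤ 256 (1 + R)²`. -/
theorem count_SL2Z (R : ℝ) (hR : 0 ≤ R) :
    ∃ s : Finset SL(2, ℤ), (∀ γ : SL(2, ℤ), κ (γ : SL(2, ℝ)) ≤ R → γ ∈ s) ∧
      (s.card : ℝ) ≤ 256 * (1 + R) ^ (2 : ℝ) := by
  set M : ℕ := ⌊Real.sqrt (2 * R)⌋₊ with hM
  have hsub : {γ : SL(2, ℤ) | κ (γ : SL(2, ℝ)) ≤ R} ⊆ entries ⁻¹' (box M : Set (ℤ × ℤ × ℤ × ℤ)) := by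
    intro γ hγ
    simp only [Set.mem_preimage, Finset.mem_coe]
    exact mem_box_of_natAbs_le (natAbs_le_of_κ_le hγ 0 0) (natAbs_le_of_κ_le hγ 0 1)
      (natAbs_le_of_κ_le hγ 1 0) (natAbs_le_of_κ_le hγ 1 1)
  have hfin : Set.Finite {γ : SL(2, ℤ) | κ (γ : SL(2, ℝ)) ≤ R} :=
    Set.Finite.subset ((box M).finite_toSet.preimage entries_injective.injOn) hsub
  refine ⟨hfin.toFinset, fun γ hγ => hfin.mem_toFinset.2 hγ, ?_⟩
  -- the cardinality through the injection into the box
  have hcard : hfin.toFinset.card ≤ (box M).card := by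
    apply Finset.card_le_card_of_injOn entries
    · intro γ hγ
      have := hsub (hfin.mem_toFinset.1 (by simpa using hγ))
      simpa using this
    · exact entries_injective.injOn
  rw [card_box] at hcard
  -- the box count against `256 (1 + R)²`
  have ht0 : 0 ≤ Real.sqrt (2 * R) := Real.sqrt_nonneg _
  have ht2 : Real.sqrt (2 * R) ^ 2 = 2 * R := Real.sq_sqrt (by linarith)
  have hMle : (M : ℝ) ≤ Real.sqrt (2 * R) := Nat.floor_le ht0
  have hu : (2 * (M : ℝ) + 1) ≤ 2 * Real.sqrt (2 * R) + 1 := by linarith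
  have hu0 : 0 ≤ 2 * (M : ℝ) + 1 := by positivity
  have hsq : (2 * Real.sqrt (2 * R) + 1) ^ 2 ≤ 16 * (1 + R) := by
    nlinarith [sq_nonneg (Real.sqrt (2 * R) - 1)]
  have hfour : ((2 * M + 1 : ℕ) : ℝ) ^ 4 ≤ 256 * (1 + R) ^ 2 := by
    have h1 : (2 * (M : ℝ) + 1) ^ 2 ≤ 16 * (1 + R) :=
      le_trans (pow_le_pow_left₀ hu0 hu 2) hsq
    have h2 : 0 ≤ (2 * (M : ℝ) + 1) ^ 2 := by positivity
    calc ((2 * M + 1 : ℕ) : ℝ) ^ 4 = ((2 * (M : ℝ) + 1) ^ 2) ^ 2 := by push_cast; ring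
      _ ≤ (16 * (1 + R)) ^ 2 := pow_le_pow_left₀ h2 h1 2
      _ = 256 * (1 + R) ^ 2 := by ring
  calc (hfin.toFinset.card : ℝ) ≤ ((2 * M + 1) ^ 4 : ℕ) := by exact_mod_cast hcard
    _ = ((2 * M + 1 : ℕ) : ℝ) ^ 4 := by push_cast; ring
    _ ≤ 256 * (1 + R) ^ 2 := hfour
    _ = 256 * (1 + R) ^ (2 : ℝ) := by rw [← Real.rpow_natCast]; norm_num

/-- the modular group as a family of lattice points in `SL(2, ℝ)`. -/
def ιZ : SL(2, ℤ) → SL(2, ℝ) := fun γ => (γ : SL(2, ℝ))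

variable (f : SL(2, ℝ) → ℂ)

/-- **absolute convergence of the Poincaré series of `SL(2, ℤ)`** at every point, for `‖f g‖ ≤ C (1 + κ g)^(-α)`, `α > 2`. -/
theorem summable_norm_kernel_SL2Z {α : ℝ} (hα : 2 < α) {C : ℝ}
    (hf : ∀ g, ‖f g‖ ≤ C * (1 + κ g) ^ (-α)) (x y : SL(2, ℝ)) :
    Summable fun γ : SL(2, ℤ) => ‖f (x⁻¹ * ιZ γ * y)‖ :=
  summable_norm_kernel_SL2 ιZ f (β := 2) (by norm_num) hα (C' := 256) count_SL2Z hf x y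

/-- **THE POINCARÉ-SERIES KERNEL OF THE MODULAR GROUP IS CONTINUOUS** on `SL(2, ℝ) × SL(2, ℝ)`: for every continuous
`f` with `‖f g‖ ≤ C (1 + κ g)^(-α)`, `α > 2`, `K_f(x, y) = Σ'_{γ ∈ SL(2, ℤ)} f (x⁻¹ γ y)` is continuous. -/
theorem continuous_kernelSum_SL2Z (hfc : Continuous f) {α : ℝ} (hα : 2 < α) {C : ℝ}
    (hf : ∀ g, ‖f g‖ ≤ C * (1 + κ g) ^ (-α)) :
    Continuous (fun p : SL(2, ℝ) × SL(2, ℝ) => PoincareKernel.kernelSum ιZ f p.1 p.2) :=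
  continuous_kernelSum_SL2 ιZ f hfc (β := 2) (by norm_num) hα (C' := 256) count_SL2Z hf

end Summit.Ventures.HodgeRepro2.Tier7.Line3.HyperbolicLatticeCount
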